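import Summits.NavierStokesRegularity.NavierStokesRegularity.Theorems.TypeICertificateLadderTargetTypeIZoom
import Summits.NavierStokesRegularity.NavierStokesRegularity.Theorems.DssFarFieldSlavingBlowupTypeIDssProfileSimilarityEnstrophyTimeOnlyThreshold
import Literature.Analysis.FluidPDE.KNSSLocalSmoothingHolds
import Literature.Analysis.FluidPDE.NSBoundedMildSmoothing
import Literature.Analysis.FluidPDE.OseenMildUniqueness
import HarnessLib

/-!
# Route TypeICertificateLadder — the Leray rate with constant `1` in the OSEEN GAUGE (no energy
  class; C31-M of cell pub-ns-dss, classical rendering; helper of crux stmt-NavierStokesRegularity-2882,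
  whose rung `X_1` is the Leray–Hopf version)

For a classical solution `(u, p)` of unforced Navier–Stokes (`ν = 1`) on `ℝ³ × (0, T)`, bounded on
every sub-slab `(0, T') × ℝ³` (`T' < T`), satisfying the Oseen integral equation
`u(t) = e^{(t−s)Δ}u(s) − B¹_s(u,u)(t)` pointwise between all pairs `0 < s < t < T` (the
Koch–Nadirashvili–Seregin–Šverák gauge, excluding the parasitic solutions `b(t)`), and unbounded on
`(0,T) × ℝ³`:
* `oseenMild_leray_lower_bound` — Leray's lower rate in the mild class: `sup_x ‖u(t,x)‖ ≥ c/√(T−t)`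
  for some `c > 0` and every `t ∈ (0,T)` (KNSS 2009 Prop. 4.1 local theory
  `knss2009_local_smoothing_holds` + uniqueness of bounded solutions `oseenMild_essBounded_unique`);
* `exists_typeIAncientMild_of_oseenMild_rate` — the Type-I ZOOM (KNSS 2009 §6, vertex shifted by
  `σ₀ = c²/2`, the tree's compactness `typeIZoom_compactness` and `isTypeIAncientMild_of_continuous_oseenMild`):
  if moreover `√(T−t)‖u(t,x)‖ ≤ C` eventually, some NON-ZERO `W` has `IsTypeIAncientMild C W` —
  verbatim the tree's `typeIZoom_unit` with its two Leray–Hopf inputs (Leray points, Oseen pairs)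
  replaced by the hypotheses above;
* `lerayRate_frequently_gt_of_oseenMild`, `one_le_limsup_lerayRate_of_oseenMild` — hence, by the
  cell's T31⁗ (`SimilarityEnstrophy.typeI_ancient_eq_zero_of_rate_lt_one`: the rate class is EMPTY at
  every level `C < 1`), `limsup_{t↑T} √(T−t)‖u(t)‖_∞ ≥ 1`.

HONEST FRAMING: statements about a HYPOTHETICAL singular time; no such solution is asserted to
exist; the constant `1` is a perturbative threshold and nothing is said at or above it; nothing
here bears on the regularity question itself. Lands `--supports stmt-NavierStokesRegularity-2882`.
-/

noncomputable section

namespace Summit.NavierStokesRegularity.NavierStokesRegularity.Theorems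

set_option linter.dupNamespace false

open MeasureTheory Set Filter Topology Function
open scoped RealInnerProductSpace ENNReal
open Literature.Analysis Literature.Analysis.FluidPDE
open Summit.NavierStokesRegularity.NavierStokesRegularity.Theorems.SimilarityEnstrophy

/-! ### Leray's lower rate for slab-bounded Oseen-mild solutions -/

/-- **Leray's lower blow-up rate in the Oseen-gauge mild class** (KNSS 2009, Prop. 4.1 and the
uniqueness of bounded mild solutions). Let `u` be jointly continuous on `(0,T) × ℝ³`, bounded on
every `(0,T') × ℝ³` (`T' < T`), Oseen-mild between all pairs of times of `(0,T)`, and unbounded on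
`(0,T) × ℝ³`. Then there is `c > 0` such that at every time `t ∈ (0,T)` some point carries
`c/√(T−t) ≤ ‖u(t,x)‖`: otherwise the local bounded solution from the datum `u(t)` (size
`< c/√(T−t)`, lifespan `ε(T−t)/c² = 2(T−t)`) coincides with `u` on `(t,T)` and bounds it there.
[cite: KochNadirashviliSereginSverak2009, Prop. 4.1 with (4.3)–(4.5) (arXiv:0709.3599 p. 8)] -/
theorem oseenMild_leray_lower_bound {T : ℝ}
    {u : ℝ → EuclideanSpace ℝ (Fin 3) → EuclideanSpace ℝ (Fin 3)}
    (hcont : ContinuousOn (uncurry u) (Ioo 0 T ×ˢ univ))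
    (hbdd : ∀ T' < T, ∃ M : ℝ, ∀ t ∈ Ioo 0 T', ∀ x, ‖u t x‖ ≤ M)
    (hoseen : ∀ s t : ℝ, 0 < s → s < t → t < T → ∀ X,
      u t X = UnboundedOperators.heatExtension (u s) (t - s) X - oseenDuhamel 1 s u u t X)
    (hunb : ∀ M : ℝ, ∃ t ∈ Ioo 0 T, ∃ x, M < ‖u t x‖) :
    ∃ c : ℝ, 0 < c ∧ ∀ t ∈ Ioo 0 T, ∃ x, c / Real.sqrt (T - t) ≤ ‖u t x‖ := by
  obtain ⟨ε, hε, CL, hCL0, hL⟩ := knss2009_local_smoothing_holds (EuclideanSpace ℝ (Fin 3)) 0 0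
  refine ⟨Real.sqrt (ε / 2), Real.sqrt_pos.2 (by positivity), fun t ht => ?_⟩
  have hTt : 0 < T - t := sub_pos.2 ht.2
  by_contra hno
  simp only [not_exists, not_le] at hno
  -- the datum bound `‖u t ·‖ ≤ Mp := √(ε/2)/√(T − t)`, with lifespan `ε/Mp² = 2(T − t)`
  set Mp : ℝ := Real.sqrt (ε / 2) / Real.sqrt (T - t) with hMpdef
  have hMp : 0 < Mp := div_pos (Real.sqrt_pos.2 (by positivity)) (Real.sqrt_pos.2 hTt)
  have hMp2 : Mp ^ 2 = ε / (2 * (T - t)) := by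
    rw [hMpdef, div_pow, Real.sq_sqrt (by positivity), Real.sq_sqrt hTt.le]
    field_simp
  have hwin : t + ε * 1 / Mp ^ 2 = t + 2 * (T - t) := by
    rw [hMp2]; field_simp
  have hut : ∀ x, ‖u t x‖ ≤ Mp := fun x => (hno x).le
  -- slices are continuous
  have hslice : ∀ τ ∈ Ioo 0 T, Continuous (u τ) := fun τ hτ =>
    hcont.comp_continuous (Continuous.prodMk_right τ) fun x => ⟨hτ, mem_univ x⟩
  have ha' : AEStronglyMeasurable (u t) volume := (hslice t ht).aestronglyMeasurable
  have hbound_top : ∀ {f : EuclideanSpace ℝ (Fin 3) → EuclideanSpace ℝ (Fin 3)} {K : ℝ},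
      (∀ x, ‖f x‖ ≤ K) → eLpNorm f ∞ volume ≤ ENNReal.ofReal K := fun hf => by
    rw [eLpNorm_exponent_top]
    exact eLpNormEssSup_le_of_ae_bound (Eventually.of_forall hf)
  have ha'M : eLpNorm (u t) ∞ volume ≤ ENNReal.ofReal Mp := hbound_top hut
  -- the local smooth solution from `u t` at time `t`
  obtain ⟨v, hvs, hveq, hvM, -⟩ := hL one_pos t hMp ha' ha'M
  -- `u = v` on every `(t, T')`, `T' < T`
  have hagree : ∀ T' : ℝ, T' < T → ∀ τ ∈ Ioo t T', ∀ x, u τ x = v τ x := by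
    intro T' hT'T τ hτ x
    have hT'le : T' ≤ t + ε * 1 / Mp ^ 2 := by rw [hwin]; linarith
    obtain ⟨M₁, hM₁⟩ := hbdd T' hT'T
    set M : ℝ := max (max M₁ (CL * Mp)) 0 with hMdef
    have hM0 : 0 ≤ M := le_max_right _ _
    have hsub : Ioo t T' ×ˢ (univ : Set (EuclideanSpace ℝ (Fin 3))) ⊆ Ioo 0 T ×ˢ univ :=
      prod_mono (Ioo_subset_Ioo ht.1.le hT'T.le) subset_rfl
    have hsub' : Ioo t T' ×ˢ (univ : Set (EuclideanSpace ℝ (Fin 3))) ⊆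
        Ioo t (t + ε * 1 / Mp ^ 2) ×ˢ univ := prod_mono (Ioo_subset_Ioo_right hT'le) subset_rfl
    have hum : AEStronglyMeasurable (uncurry u)
        ((volume : Measure (ℝ × EuclideanSpace ℝ (Fin 3))).restrict (Ioo t T' ×ˢ univ)) :=
      (hcont.mono hsub).aestronglyMeasurable (measurableSet_Ioo.prod MeasurableSet.univ)
    have hvm : AEStronglyMeasurable (uncurry v)
        ((volume : Measure (ℝ × EuclideanSpace ℝ (Fin 3))).restrict (Ioo t T' ×ˢ univ)) :=
      (hvs.continuousOn.mono hsub').aestronglyMeasurable (measurableSet_Ioo.prod MeasurableSet.univ)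
    have huM : ∀ τ ∈ Ioo t T', eLpNorm (u τ) ∞ volume ≤ ENNReal.ofReal M := fun τ hτ =>
      hbound_top fun x => (hM₁ τ ⟨ht.1.trans hτ.1, hτ.2⟩ x).trans
        ((le_max_left _ _).trans (le_max_left _ _))
    have hvM' : ∀ τ ∈ Ioo t T', eLpNorm (v τ) ∞ volume ≤ ENNReal.ofReal M := fun τ hτ =>
      hbound_top fun x => (hvM τ ⟨hτ.1, hτ.2.trans_le hT'le⟩ x).trans
        ((le_max_right _ _).trans (le_max_left _ _))
    have husol : ∀ τ ∈ Ioo t T', u τ =ᵐ[volume] fun x =>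
        UnboundedOperators.heatExtension (u t) (1 * (τ - t)) x - oseenDuhamel 1 t u u τ x :=
      fun τ hτ => Eventually.of_forall fun x => by
        rw [one_mul]; exact hoseen t τ ht.1 hτ.1 (hτ.2.trans hT'T) x
    have hvsol : ∀ τ ∈ Ioo t T', v τ =ᵐ[volume] fun x =>
        UnboundedOperators.heatExtension (u t) (1 * (τ - t)) x - oseenDuhamel 1 t v v τ x :=
      fun τ hτ => Eventually.of_forall fun x => hveq τ ⟨hτ.1, hτ.2.trans_le hT'le⟩ x
    have hae := oseenMild_essBounded_unique
      (U := fun τ x => UnboundedOperators.heatExtension (u t) (1 * (τ - t)) x)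
      one_pos hM0 hum hvm huM hvM' husol hvsol τ hτ
    have hcu : Continuous (u τ) := hslice τ ⟨ht.1.trans hτ.1, hτ.2.trans hT'T⟩
    have hcv : Continuous (v τ) :=
      hvs.continuousOn.comp_continuous (Continuous.prodMk_right τ) fun x =>
        ⟨⟨hτ.1, hτ.2.trans_le hT'le⟩, mem_univ x⟩
    exact congrFun ((hcu.ae_eq_iff_eq (μ := volume) hcv).1 hae) x
  -- `u` is bounded by `CL · Mp` on `(t, T)` and by a slab bound before: contradiction
  have hafter : ∀ τ ∈ Ioo t T, ∀ x, ‖u τ x‖ ≤ CL * Mp := by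
    intro τ hτ x
    set T' : ℝ := (τ + T) / 2 with hT'def
    have hT'T : T' < T := by rw [hT'def]; linarith [hτ.2]
    have hτT' : τ < T' := by rw [hT'def]; linarith [hτ.2]
    have hT'le : T' ≤ t + ε * 1 / Mp ^ 2 := by rw [hwin]; linarith
    rw [hagree T' hT'T τ ⟨hτ.1, hτT'⟩ x]
    exact hvM τ ⟨hτ.1, hτT'.trans_le hT'le⟩ x
  set T₂ : ℝ := (t + T) / 2 with hT₂def
  have hT₂T : T₂ < T := by rw [hT₂def]; linarith [ht.2]
  have htT₂ : t < T₂ := by rw [hT₂def]; linarith [ht.2]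
  obtain ⟨M₂, hM₂⟩ := hbdd T₂ hT₂T
  obtain ⟨τ, hτ, x, hx⟩ := hunb (max M₂ (CL * Mp))
  rcases lt_or_ge τ T₂ with hlt | hge
  · exact absurd (hM₂ τ ⟨hτ.1, hlt⟩ x) (not_le.2 ((le_max_left _ _).trans_lt hx))
  · exact absurd (hafter τ ⟨htT₂.trans_le hge, hτ.2⟩ x)
      (not_le.2 ((le_max_right _ _).trans_lt hx))

/-! ### The Type-I zoom in the Oseen gauge -/

/-- **The Type-I zoom for slab-bounded Oseen-mild classical solutions** (KNSS 2009, §6, proof of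
Theorem 6.2 with Lemma 6.1, the vertex shifted by `σ₀ = c²/2`; verbatim the tree's
`typeIZoom_unit` with its two Leray–Hopf inputs — Leray points and the Oseen equation between all
pairs of positive times — taken as hypotheses). For `C, c > 0`, `T > 0`, `(u, p)` classical
(`ν = 1`) on `ℝ³ × (0,T)`, Oseen-mild between all pairs of times of `(0,T)`, with
`c/√(T−t) ≤ ‖u(t,x_t)‖` for some `x_t` at every `t ∈ (0,T)` and `√(T−t)‖u(t,x)‖ ≤ C` eventually
as `t ↑ T`: there is `W` with `IsTypeIAncientMild C W` and `W(t,x) ≠ 0` for some `t < 0`.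
[cite: KochNadirashviliSereginSverak2009, §6 proof of Thm 6.2 with Lemma 6.1 (arXiv:0709.3599 pp. 11–13)] -/
theorem exists_typeIAncientMild_of_oseenMild_rate {C c T : ℝ} (hC : 0 < C) (hc : 0 < c) (hT : 0 < T)
    {u : ℝ → EuclideanSpace ℝ (Fin 3) → EuclideanSpace ℝ (Fin 3)}
    {p : ℝ → EuclideanSpace ℝ (Fin 3) → ℝ}
    (hcl : IsClassicalNSSolutionOn (Ioo 0 T) 1 0 u p)
    (hoseen : ∀ s t : ℝ, 0 < s → s < t → t < T → ∀ X,
      u t X = UnboundedOperators.heatExtension (u s) (t - s) X - oseenDuhamel 1 s u u t X)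
    (hler : ∀ t ∈ Ioo 0 T, ∃ x, c / Real.sqrt (T - t) ≤ ‖u t x‖)
    (hrate : ∀ᶠ t in 𝓝[<] T, ∀ x, Real.sqrt (T - t) * ‖u t x‖ ≤ C) :
    ∃ W : ℝ → EuclideanSpace ℝ (Fin 3) → EuclideanSpace ℝ (Fin 3),
      IsTypeIAncientMild C W ∧ ¬ (∀ t < 0, ∀ x, W t x = 0) := by
  -- adapted from `typeIZoom_unit` (TypeICertificateLadderTargetTypeIZoom.lean): rate window `(T', T)`
  obtain ⟨T₀, hT₀T, hT₀⟩ := mem_nhdsLT_iff_exists_Ioo_subset.1 hrate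
  set T' : ℝ := max T₀ (T / 2) with hT'def
  have hT'T : T' < T := max_lt hT₀T (by linarith)
  have hT'pos : 0 < T' := lt_of_lt_of_le (by linarith) (le_max_right _ _)
  have hrate' : ∀ t ∈ Ioo T' T, ∀ x, Real.sqrt (T - t) * ‖u t x‖ ≤ C := fun t ht x =>
    hT₀ ⟨lt_of_le_of_lt (le_max_left _ _) ht.1, ht.2⟩ x
  -- ### near-Leray points along `t_k ↑ T`
  set δ : ℝ := T - T' with hδ
  have hδpos : 0 < δ := sub_pos.2 hT'T
  set tk : ℕ → ℝ := fun k => T - δ / ((k : ℝ) + 2) with htk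
  have hk2 : ∀ k : ℕ, (0 : ℝ) < (k : ℝ) + 2 := fun k => by positivity
  have hTtk : ∀ k, T - tk k = δ / ((k : ℝ) + 2) := fun k => by simp [htk]
  have htk_lt : ∀ k, tk k < T := fun k => by
    have : 0 < δ / ((k : ℝ) + 2) := div_pos hδpos (hk2 k)
    simp only [htk]; linarith
  have htk_gt : ∀ k, T' < tk k := fun k => by
    have : δ / ((k : ℝ) + 2) < δ := div_lt_self hδpos (by linarith [Nat.cast_nonneg (α := ℝ) k])
    simp only [htk]; linarith
  have htk_ge : ∀ k, T' + δ / 2 ≤ tk k := fun k => by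
    have : δ / ((k : ℝ) + 2) ≤ δ / 2 :=
      div_le_div_of_nonneg_left hδpos.le two_pos (by linarith [Nat.cast_nonneg (α := ℝ) k])
    simp only [htk]; linarith
  have htk0 : ∀ k, 0 < tk k := fun k => hT'pos.trans (htk_gt k)
  have hpt : ∀ k, ∃ x, c / Real.sqrt (T - tk k) ≤ ‖u (tk k) x‖ := fun k =>
    hler (tk k) ⟨htk0 k, htk_lt k⟩
  choose xk hxk using hpt
  set M : ℕ → ℝ := fun k => ‖u (tk k) (xk k)‖ with hMdef
  have hsqpos : ∀ k, 0 < Real.sqrt (T - tk k) := fun k => Real.sqrt_pos.2 (sub_pos.2 (htk_lt k))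
  have hMlow : ∀ k, c / Real.sqrt (T - tk k) ≤ M k := hxk
  have hMpos : ∀ k, 0 < M k := fun k => lt_of_lt_of_le (div_pos hc (hsqpos k)) (hMlow k)
  have hcle : ∀ k, c ≤ Real.sqrt (T - tk k) * M k := fun k => by
    have h := (div_le_iff₀ (hsqpos k)).1 (hMlow k)
    rwa [mul_comm] at h
  -- `S_k = (T − t_k) M_k² ≥ c²`
  have hS : ∀ k, c ^ 2 ≤ (T - tk k) * M k ^ 2 := fun k => by
    have h := pow_le_pow_left₀ hc.le (hcle k) 2
    rwa [mul_pow, Real.sq_sqrt (sub_pos.2 (htk_lt k)).le] at h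
  -- `M_k² ≥ c² (k + 2) / δ`
  have hM2 : ∀ k : ℕ, c ^ 2 * ((k : ℝ) + 2) / δ ≤ M k ^ 2 := fun k => by
    have h := hS k
    rw [hTtk k] at h
    rw [div_le_iff₀ hδpos]
    have e : δ / ((k : ℝ) + 2) * M k ^ 2 * ((k : ℝ) + 2) = M k ^ 2 * δ := by
      field_simp
    have h2 := mul_le_mul_of_nonneg_right h (hk2 k).le
    rw [e] at h2
    linarith
  -- ### the zoom with the vertex shifted by `σ₀ = c²/2`
  set σ₀ : ℝ := c ^ 2 / 2 with hσ₀def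
  have hσ₀ : 0 < σ₀ := by positivity
  set lam : ℕ → ℝ := fun k => (M k)⁻¹ with hlamdef
  have hlam : ∀ k, 0 < lam k := fun k => inv_pos.2 (hMpos k)
  have hlamM : ∀ k, lam k * M k = 1 := fun k => inv_mul_cancel₀ (hMpos k).ne'
  have hlam2 : ∀ k, lam k ^ 2 * M k ^ 2 = 1 := fun k => by rw [← mul_pow, hlamM, one_pow]
  set t0 : ℕ → ℝ := fun k => tk k + σ₀ * lam k ^ 2 with ht0def
  set w : ℕ → ℝ → EuclideanSpace ℝ (Fin 3) → EuclideanSpace ℝ (Fin 3) :=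
    fun k => lam k • stPull (lam k ^ 2) (lam k) (t0 k) (xk k) u with hwdef
  set q : ℕ → ℝ → EuclideanSpace ℝ (Fin 3) → ℝ :=
    fun k => lam k ^ 2 • stPull (lam k ^ 2) (lam k) (t0 k) (xk k) p with hqdef
  set A : ℕ → ℝ := fun k => (T' - t0 k) * M k ^ 2 with hAdef
  set B : ℕ → ℝ := fun k => (T - t0 k) * M k ^ 2 with hBdef
  -- the physical time of `τ` is `t₀ + λ² τ`; `A_k ↦ T'`, `B_k ↦ T`
  have hphysA : ∀ k, t0 k + lam k ^ 2 * A k = T' := fun k => by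
    have e : lam k ^ 2 * ((T' - t0 k) * M k ^ 2) = (T' - t0 k) * (lam k ^ 2 * M k ^ 2) := by ring
    simp only [hAdef]
    rw [e, hlam2, mul_one]
    ring
  have hphysB : ∀ k, t0 k + lam k ^ 2 * B k = T := fun k => by
    have e : lam k ^ 2 * ((T - t0 k) * M k ^ 2) = (T - t0 k) * (lam k ^ 2 * M k ^ 2) := by ring
    simp only [hBdef]
    rw [e, hlam2, mul_one]
    ring
  have hphys_lt : ∀ k, ∀ {σ τ : ℝ}, σ < τ → t0 k + lam k ^ 2 * σ < t0 k + lam k ^ 2 * τ :=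
    fun k σ τ h => by have := pow_pos (hlam k) 2; nlinarith
  have hphys : ∀ k, ∀ τ ∈ Ioo (A k) (B k), t0 k + lam k ^ 2 * τ ∈ Ioo T' T := fun k τ hτ =>
    ⟨by rw [← hphysA k]; exact hphys_lt k hτ.1, by rw [← hphysB k]; exact hphys_lt k hτ.2⟩
  -- `B_k = S_k − σ₀ ≥ σ₀ > 0`, `T − t₀ > 0`
  have hBeq : ∀ k, B k = (T - tk k) * M k ^ 2 - σ₀ := fun k => by
    simp only [hBdef, ht0def]
    have := hlam2 k
    linear_combination (-σ₀) * this
  have hBpos : ∀ k, 0 < B k := fun k => by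
    rw [hBeq k]
    have := hS k
    simp only [hσ₀def]
    nlinarith
  have hTt0 : ∀ k, 0 < T - t0 k := fun k => by
    have h1 : 0 < (T - t0 k) * M k ^ 2 := hBpos k
    exact lt_of_mul_lt_mul_right (by rwa [zero_mul]) (sq_nonneg (M k))
  -- `A_k → −∞`
  have hA_le : ∀ k : ℕ, A k ≤ -(c ^ 2 / 2) * ((k : ℝ) + 2) - σ₀ := fun k => by
    have hAeq : A k = (T' - tk k) * M k ^ 2 - σ₀ := by
      simp only [hAdef, ht0def]
      have := hlam2 k
      linear_combination (-σ₀) * this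
    rw [hAeq]
    have h1 : T' - tk k ≤ -(δ / 2) := by linarith [htk_ge k]
    have hM2k := hM2 k
    have hM20 : 0 ≤ M k ^ 2 := sq_nonneg _
    have h2 : (T' - tk k) * M k ^ 2 ≤ -(δ / 2) * M k ^ 2 := mul_le_mul_of_nonneg_right h1 hM20
    have h3 : -(δ / 2) * M k ^ 2 ≤ -(δ / 2) * (c ^ 2 * ((k : ℝ) + 2) / δ) :=
      mul_le_mul_of_nonpos_left hM2k (by linarith)
    have h4 : -(δ / 2) * (c ^ 2 * ((k : ℝ) + 2) / δ) = -(c ^ 2 / 2) * ((k : ℝ) + 2) := by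
      field_simp
    linarith
  have hAlim : Tendsto A atTop atBot := by
    have h1 : Tendsto (fun k : ℕ => (k : ℝ) + 2) atTop atTop :=
      tendsto_atTop_add_const_right _ _ tendsto_natCast_atTop_atTop
    have hneg : -(c ^ 2 / 2) < 0 := by linarith
    have h2 : Tendsto (fun k : ℕ => -(c ^ 2 / 2) * ((k : ℝ) + 2)) atTop atBot :=
      h1.const_mul_atTop_of_neg hneg
    exact tendsto_atBot_mono hA_le (tendsto_atBot_add_const_right _ _ h2)
  -- the zoomed fields are classical on `(A_k, B_k)`
  have hwcl : ∀ k, IsClassicalNSSolutionOn (Ioo (A k) (B k)) 1 0 (w k) (q k) := by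
    intro k
    have h := hcl.nsRescale_translate_zero (hlam k) (t0 k) (xk k)
    refine h.mono (fun τ hτ => ?_) isOpen_Ioo.uniqueDiffOn
    have hp := hphys k τ hτ
    exact ⟨hT'pos.trans hp.1, hp.2⟩
  -- the Oseen equation between all times of `(A_k, B_k)`
  have hwmild : ∀ k, ∀ s t : ℝ, A k < s → s < t → t < B k → ∀ y,
      w k t y = UnboundedOperators.heatExtension (w k s) (t - s) y -
        oseenDuhamel 1 s (w k) (w k) t y := by
    intro k s t hAs hst htB y
    refine oseen_smul_stPull (hlam k) (t0 k) (xk k) hst (fun X => ?_) y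
    have hsB : s < B k := hst.trans htB
    have hs' : T' < t0 k + lam k ^ 2 * s := (hphys k s ⟨hAs, hsB⟩).1
    have ht' : t0 k + lam k ^ 2 * t < T := (hphys k t ⟨hAs.trans hst, htB⟩).2
    exact hoseen _ _ (hT'pos.trans hs') (hphys_lt k hst) ht' X
  -- the rate bound on `(A_k, 0)`
  have hwI : ∀ k, ∀ τ ∈ Ioo (A k) 0, ∀ y, Real.sqrt (-τ) * ‖w k τ y‖ ≤ C := by
    intro k τ hτ y
    have e : w k τ y = lam k • u (t0 k + lam k ^ 2 * τ) (xk k + lam k • y) := rfl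
    have ht : t0 k + lam k ^ 2 * τ ∈ Ioo T' T := hphys k τ ⟨hτ.1, hτ.2.trans (hBpos k)⟩
    have hr := hrate' _ ht (xk k + lam k • y)
    rw [e, norm_smul, Real.norm_eq_abs, abs_of_pos (hlam k)]
    have hkey : Real.sqrt (-τ) * lam k ≤ Real.sqrt (T - (t0 k + lam k ^ 2 * τ)) := by
      have e1 : Real.sqrt (-τ) * lam k = Real.sqrt (-τ * lam k ^ 2) := by
        rw [Real.sqrt_mul (neg_nonneg.2 hτ.2.le), Real.sqrt_sq (hlam k).le]
      rw [e1]
      refine Real.sqrt_le_sqrt ?_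
      have := hTt0 k
      nlinarith [pow_pos (hlam k) 2]
    calc Real.sqrt (-τ) * (lam k * ‖u (t0 k + lam k ^ 2 * τ) (xk k + lam k • y)‖)
        = (Real.sqrt (-τ) * lam k) * ‖u (t0 k + lam k ^ 2 * τ) (xk k + lam k • y)‖ := by ring
      _ ≤ Real.sqrt (T - (t0 k + lam k ^ 2 * τ)) * ‖u (t0 k + lam k ^ 2 * τ) (xk k + lam k • y)‖ :=
          mul_le_mul_of_nonneg_right hkey (norm_nonneg _)
      _ ≤ C := hr
  -- `‖w_k(−σ₀, 0)‖ = 1`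
  have hneg : -σ₀ < 0 := neg_neg_of_pos hσ₀
  have hnorm1 : ∀ k, ‖w k (-σ₀) 0‖ = 1 := fun k => by
    have e : w k (-σ₀) 0 =
        lam k • u (t0 k + lam k ^ 2 * (-σ₀)) (xk k + lam k • (0 : EuclideanSpace ℝ (Fin 3))) := rfl
    have et : t0 k + lam k ^ 2 * (-σ₀) = tk k := by simp only [ht0def]; ring
    rw [e, et, smul_zero, add_zero, norm_smul, Real.norm_eq_abs, abs_of_pos (hlam k)]
    exact hlamM k
  -- ### compactness and the limit
  obtain ⟨φ, W, -, hWc, hWdiv, hWI, hWmild, hWconv⟩ :=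
    typeIZoom_compactness C A B w q hC hAlim hBpos hwcl hwmild hwI
  refine ⟨W, isTypeIAncientMild_of_continuous_oseenMild hWc hWdiv hWmild (fun t ht x => ?_),
    fun h0 => ?_⟩
  · rw [le_div_iff₀ (Real.sqrt_pos.2 (neg_pos.2 ht)), mul_comm]
    exact hWI t ht x
  · have hlim : Tendsto (fun k => w (φ k) (-σ₀) 0) atTop (𝓝 (W (-σ₀) 0)) :=
      (tendstoLocallyUniformlyOn_univ.2 (hWconv (-σ₀) hneg)).tendsto_at (mem_univ _)
    have hlim1 : Tendsto (fun k => ‖w (φ k) (-σ₀) 0‖) atTop (𝓝 ‖W (-σ₀) 0‖) := hlim.norm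
    have hone : Tendsto (fun k => ‖w (φ k) (-σ₀) 0‖) atTop (𝓝 1) := by
      simp only [hnorm1]
      exact tendsto_const_nhds
    have hW1 : ‖W (-σ₀) 0‖ = 1 := tendsto_nhds_unique hlim1 hone
    rw [h0 (-σ₀) hneg 0, norm_zero] at hW1
    exact zero_ne_one hW1

/-! ### C31-M: the Leray rate with constant `1` in the Oseen gauge -/

/-- **Leray rate with constant one in the Oseen gauge (C31-M, classical rendering).** Let
`(u, p)` be a classical solution of the unforced Navier–Stokes system (`ν = 1`) on `ℝ³ × (0,T)`,
`T > 0`, bounded on every `(0,T') × ℝ³` (`T' < T`), satisfying the Oseen integral equation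
between all pairs of times of `(0,T)` (KNSS gauge), and unbounded on `(0,T) × ℝ³`. Then for every
`θ < 1`: `θ < √(T−t)‖u(t,x)‖` for some `x`, frequently as `t ↑ T` — i.e.
`limsup_{t↑T} √(T−t)‖u(t)‖_∞ ≥ 1`. NO energy inequality, NO decay of the data, NO Leray–Hopf
structure. Proof: otherwise `√(T−t)‖u‖ ≤ θ' := max θ ½ < 1` eventually; Leray's lower rate
(`oseenMild_leray_lower_bound`) and the zoom (`exists_typeIAncientMild_of_oseenMild_rate`) give a
NON-ZERO `IsTypeIAncientMild θ' W`, contradicting T31⁗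
(`SimilarityEnstrophy.typeI_ancient_eq_zero_of_rate_lt_one`, cell pub-ns-dss). Nothing is claimed
at or above the threshold. [this file; KNSS 2009 §4, §6 + pub-ns-dss T31⁗] -/
theorem lerayRate_frequently_gt_of_oseenMild {T : ℝ} (hT : 0 < T)
    {u : ℝ → EuclideanSpace ℝ (Fin 3) → EuclideanSpace ℝ (Fin 3)}
    {p : ℝ → EuclideanSpace ℝ (Fin 3) → ℝ}
    (hcl : IsClassicalNSSolutionOn (Ioo 0 T) 1 0 u p)
    (hbdd : ∀ T' < T, ∃ M : ℝ, ∀ t ∈ Ioo 0 T', ∀ x, ‖u t x‖ ≤ M)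
    (hoseen : ∀ s t : ℝ, 0 < s → s < t → t < T → ∀ X,
      u t X = UnboundedOperators.heatExtension (u s) (t - s) X - oseenDuhamel 1 s u u t X)
    (hunb : ∀ M : ℝ, ∃ t ∈ Ioo 0 T, ∃ x, M < ‖u t x‖) {θ : ℝ} (hθ : θ < 1) :
    ∃ᶠ t in 𝓝[<] T, ∃ x, θ < Real.sqrt (T - t) * ‖u t x‖ := by
  by_contra h
  simp only [Filter.not_frequently, not_exists, not_lt] at h
  set θ' : ℝ := max θ (1 / 2) with hθ'def
  have hθ'pos : 0 < θ' := lt_of_lt_of_le one_half_pos (le_max_right _ _)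
  have hθ'1 : θ' < 1 := max_lt hθ (by norm_num)
  have hrate : ∀ᶠ t in 𝓝[<] T, ∀ x, Real.sqrt (T - t) * ‖u t x‖ ≤ θ' :=
    h.mono fun t ht x => (ht x).trans (le_max_left _ _)
  have hcont : ContinuousOn (uncurry u) (Ioo 0 T ×ˢ univ) := hcl.smooth_velocity.continuousOn
  obtain ⟨c, hc, hler⟩ := oseenMild_leray_lower_bound hcont hbdd hoseen hunb
  obtain ⟨W, hW, hne⟩ := exists_typeIAncientMild_of_oseenMild_rate hθ'pos hc hT hcl hoseen hler hrate
  exact hne (typeI_ancient_eq_zero_of_rate_lt_one hW hθ'1)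

/-- **C31-M, `limsup` form: `limsup_{t ↑ T} √(T − t)‖u(t)‖_∞ ≥ 1`** under the hypotheses of
`lerayRate_frequently_gt_of_oseenMild` (the spatial supremum taken in `ℝ≥0∞`, so that no
boundedness of the slices near `T` is presupposed). [this file] -/
theorem one_le_limsup_lerayRate_of_oseenMild {T : ℝ} (hT : 0 < T)
    {u : ℝ → EuclideanSpace ℝ (Fin 3) → EuclideanSpace ℝ (Fin 3)}
    {p : ℝ → EuclideanSpace ℝ (Fin 3) → ℝ}
    (hcl : IsClassicalNSSolutionOn (Ioo 0 T) 1 0 u p)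
    (hbdd : ∀ T' < T, ∃ M : ℝ, ∀ t ∈ Ioo 0 T', ∀ x, ‖u t x‖ ≤ M)
    (hoseen : ∀ s t : ℝ, 0 < s → s < t → t < T → ∀ X,
      u t X = UnboundedOperators.heatExtension (u s) (t - s) X - oseenDuhamel 1 s u u t X)
    (hunb : ∀ M : ℝ, ∃ t ∈ Ioo 0 T, ∃ x, M < ‖u t x‖) :
    1 ≤ Filter.limsup (fun t => ⨆ x, ENNReal.ofReal (Real.sqrt (T - t) * ‖u t x‖)) (𝓝[<] T) := by
  refine le_of_forall_lt_imp_le_of_dense fun a ha => ?_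
  have ha' : a ≠ ⊤ := ne_top_of_lt ha
  have hθ : a.toReal < 1 := by
    have := (ENNReal.toReal_lt_toReal ha' ENNReal.one_ne_top).2 ha
    simpa using this
  have hfr := lerayRate_frequently_gt_of_oseenMild hT hcl hbdd hoseen hunb hθ
  refine Filter.le_limsup_of_frequently_le (hfr.mono ?_)
  rintro t ⟨x, hx⟩
  refine le_iSup_of_le x ?_
  rw [← ENNReal.ofReal_toReal ha']
  exact ENNReal.ofReal_le_ofReal hx.le

end Summit.NavierStokesRegularity.NavierStokesRegularity.Theorems

end
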